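import Mathlib.LinearAlgebra.SymplecticGroup
import Mathlib.LinearAlgebra.Matrix.BilinearForm
import Mathlib.LinearAlgebra.BilinearForm.Orthogonal
import Mathlib.LinearAlgebra.FiniteDimensional.Lemmas
import Mathlib.LinearAlgebra.Dimension.Constructions
import Literature.NumberTheory.GaloisRepresentations.GaloisRep
import HarnessLib

/-!
# `GSp`-valued framed representations (symplectic similitudes with a multiplier)

Definition item `defn-IsGSpValued` (route `GSpinRung` of the summit `Langlands`, items
`stmt-Langlands-3391/3393/3394`, where the notion is inlined for `n = 6`, `A = ℚ̄_p`).

A framed representation `ρ : G →ₜ* GL_n(A)` over a commutative (topological) ring `A` is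
**`GSp`-valued** (`Literature.NumberTheory.GaloisRepresentations.FramedRep.IsGSpValued`) if there
is a perfect alternating pairing `⟨x, y⟩ = xᵀ J y` on `Aⁿ` — `J` an *alternating* matrix
(`Jᵀ = -J` with zero diagonal) with `det J ∈ Aˣ` — and a function `ν : G → A`, the
**multiplier** (similitude factor), with `⟨ρ(g) x, ρ(g) y⟩ = ν(g) ⟨x, y⟩`, i.e.
`ρ(g)ᵀ J ρ(g) = ν(g) J` for all `g`.  In other words `ρ` factors through the general symplectic
group `GSp(J) = {g ∈ GL_n : gᵀ J g = ν(g) J}` of the alternating form `J`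
([BoxerEtAl2021, §2.1.1] for `n = 4`, written there with the transposed convention
`g J gᵀ = ν(g) J`, which defines the same class of representations since
`gᵀ J g = ν J ↔ g J⁻¹ gᵀ = ν J⁻¹`).

## Main definitions and results

* `IsSimilitude J ν g : Prop := gᵀ * J * g = ν • J` (matrix level, any commutative ring) with its
  algebra: `IsSimilitude.one/mul/conj/map/submatrix`, `det_sq_mul`
  (`det g ^ 2 · det J = ν ^ n · det J`), uniqueness of the multiplier (`multiplier_eq`) and
  `isUnit_multiplier`.
* `FramedRep.IsGSpValued ρ` (the definition requested) and the unfolding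
  `FramedRep.isGSpValued_iff`; over a field of characteristic `≠ 2` the literal shape used by the
  route (`det J ≠ 0`, `Jᵀ = -J`, no diagonal clause): `FramedRep.isGSpValued_iff_det_ne_zero`.
* Stability: `FramedRep.IsGSpValued.conj` (change of frame `FramedRep.conj`),
  `FramedRep.IsGSpValued.comp` and `FramedGaloisRep.IsGSpValued.restrictField`
  (restriction to `Γ_L`), `FramedRep.IsGSpValued.baseChange`.
* The multiplier is automatically a continuous character `G →ₜ* Aˣ`:
  `FramedRep.multiplier_mul/one`, `FramedRep.isUnit_multiplier`,
  `FramedRep.IsGSpValued.exists_continuousMonoidHom`.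
* Determinant: over a field, `det g = ν ^ (n / 2)` for every similitude `g` of a non-degenerate
  alternating `J` and `n` is even (`det_eq_pow_of_alternating`, `even_of_alternating`,
  `FramedRep.IsGSpValued.even`, `FramedRep.IsGSpValued.det_eq_pow`).  The proof reduces `J` to
  Mathlib's standard `Matrix.J` by a symplectic basis (McDuff–Salamon, Thm. 2.1.3) and uses
  Mathlib's `SymplecticGroup.det_eq_one` after rescaling by `diag(1, ν⁻¹)`.
* Oddness: for a number field with a real place, `det ρ(c) = ν(c) ^ (n/2)` and `ν(c) = ±1` for a
  complex conjugation `c`; hence if `n / 2` is odd (e.g. `GSp_6`, the route's case)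
  `FramedGaloisRep.IsOdd ρ ↔ ∀ c, ν(c) = -1` (`FramedGaloisRep.isOdd_iff_multiplier`), the
  "odd `GSp`" condition of [BoxerEtAl2021, §7.6, Definition ("`ρ̄` is odd if the similitude
  character `ψ` is odd, i.e. `ψ(c_v) = -1`")]; whereas if `n / 2` is even (e.g. `GSp_4`)
  `det ρ(c) = 1` (`FramedGaloisRep.det_complexConjugation_eq_one`), so the two notions of oddness
  differ there.

## Implementation notes

* "Alternating" is `Jᵀ = -J ∧ ∀ i, J i i = 0`; the diagonal clause is what makes the notion correct
  in characteristic `2` (residual representations mod `2`) and is automatic when `2` is not a zero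
  divisor (`isGSpValued_iff_det_ne_zero`).
* The symplectic basis theorem over a field is proved in the tree in
  `Literature.Geometry.Symplectic.GromovR4RelEndProofs` (`exists_symplectic_families`); that file
  imports manifold theory, so the short induction is re-proved here privately
  (`exists_symplectic_families_aux'`) rather than imported into the Galois-representation cone.
* The matrix-form predicate `PreservesMatrixForm J g : gᵀ J g = J` of
  `Literature/Barriers/Langlands/TwistedEndoscopySelfDual.lean` is `IsSimilitude J 1 g`
  (`isSimilitude_one_iff`); barrier files import literature, not conversely, so it is not reused
  by import.

## References

* [BoxerEtAl2021] G. Boxer, F. Calegari, T. Gee, V. Pilloni, *Abelian surfaces over totally real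
  fields are potentially modular*, Publ. Math. IHÉS 134 (2021), §2.1.1 (`GSp_4`, similitude
  factor `ν`), §7.6 (odd `GSp_4`-valued representations).
* [BarnetlambEtAl2014] T. Barnet-Lamb, T. Gee, D. Geraghty, R. Taylor, *Potential automorphy and
  change of weight*, Ann. of Math. 179 (2014), §2.1 (polarized representations `(r, μ)` with a
  perfect pairing `⟨r(σ)x, r(σ)y⟩ = μ(σ)⟨x, y⟩`).
* [McDuffSalamon2017] D. McDuff, D. Salamon, *Introduction to Symplectic Topology*, 3rd ed.,
  Thm. 2.1.3 (symplectic bases).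
-/

noncomputable section

open Matrix

namespace Literature.NumberTheory.GaloisRepresentations

/-! ### Similitudes of a bilinear form (matrix level) -/

section Similitude

variable {ι : Type*} [Fintype ι] {R : Type*} [CommRing R]

/-- `g` is a **similitude with multiplier `ν`** of the bilinear form `⟨x, y⟩ = xᵀ J y` with Gram
matrix `J`: `gᵀ J g = ν J`, i.e. `⟨g x, g y⟩ = ν ⟨x, y⟩` for all `x, y`.  For `J` invertible
alternating this is membership in the general symplectic group `GSp(J)` with similitude factor
`ν` [cite: BoxerEtAl2021, §2.1.1]. -/
def IsSimilitude (J : Matrix ι ι R) (ν : R) (g : Matrix ι ι R) : Prop :=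
  gᵀ * J * g = ν • J

/-- Unfolding lemma for `IsSimilitude`. [folklore] -/
theorem isSimilitude_iff {J : Matrix ι ι R} {ν : R} {g : Matrix ι ι R} :
    IsSimilitude J ν g ↔ gᵀ * J * g = ν • J :=
  Iff.rfl

/-- Multiplier `1`: `g` preserves the form, `gᵀ J g = J` (the predicate `PreservesMatrixForm` of
the twisted-endoscopy barrier file). [folklore] -/
theorem isSimilitude_one_iff {J g : Matrix ι ι R} : IsSimilitude J 1 g ↔ gᵀ * J * g = J := by
  rw [IsSimilitude, one_smul]

/-- The identity is a similitude with multiplier `1`. [folklore] -/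
theorem IsSimilitude.one [DecidableEq ι] (J : Matrix ι ι R) : IsSimilitude J 1 1 := by
  simp [IsSimilitude]

/-- Similitudes compose and multipliers multiply. [folklore] -/
theorem IsSimilitude.mul {J g h : Matrix ι ι R} {ν μ : R} (hg : IsSimilitude J ν g)
    (hh : IsSimilitude J μ h) : IsSimilitude J (ν * μ) (g * h) := by
  unfold IsSimilitude at *
  calc (g * h)ᵀ * J * (g * h) = hᵀ * (gᵀ * J * g) * h := by
        rw [transpose_mul]; simp only [Matrix.mul_assoc]
    _ = (ν * μ) • J := by rw [hg, Matrix.mul_smul, Matrix.smul_mul, hh, smul_smul]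

/-- Taking determinants: `det g ^ 2 · det J = ν ^ n · det J`. [folklore] -/
theorem IsSimilitude.det_sq_mul [DecidableEq ι] {J g : Matrix ι ι R} {ν : R} (h : IsSimilitude J ν g) :
    g.det ^ 2 * J.det = ν ^ Fintype.card ι * J.det := by
  have := congrArg det h
  rwa [det_mul, det_mul, det_transpose, det_smul, mul_right_comm, ← sq] at this

/-- For `det J ∈ Rˣ`: `det g ^ 2 = ν ^ n`. [folklore] -/
theorem IsSimilitude.det_sq [DecidableEq ι] {J g : Matrix ι ι R} {ν : R} (hJ : IsUnit J.det)
    (h : IsSimilitude J ν g) : g.det ^ 2 = ν ^ Fintype.card ι :=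
  hJ.mul_left_injective h.det_sq_mul

/-- The multiplier is determined by `g` (for `J` invertible and `n ≥ 1`).
[cite: BoxerEtAl2021, §2.1.1] -/
theorem IsSimilitude.multiplier_eq [DecidableEq ι] [Nonempty ι] {J g : Matrix ι ι R} {ν μ : R}
    (hJ : IsUnit J.det) (h₁ : IsSimilitude J ν g) (h₂ : IsSimilitude J μ g) : ν = μ := by
  have h : (ν • J) * J⁻¹ = (μ • J) * J⁻¹ := by rw [← h₁, ← h₂]
  rw [Matrix.smul_mul, Matrix.smul_mul, mul_nonsing_inv _ hJ] at h
  obtain ⟨i⟩ := ‹Nonempty ι›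
  simpa using congrFun (congrFun h i) i

/-- The multiplier of an invertible similitude of an invertible form is a unit (`n ≥ 1`).
[cite: BoxerEtAl2021, §2.1.1] -/
theorem IsSimilitude.isUnit_multiplier [DecidableEq ι] [Nonempty ι] {J g : Matrix ι ι R} {ν : R}
    (hJ : IsUnit J.det) (hg : IsUnit g.det) (h : IsSimilitude J ν g) : IsUnit ν := by
  have hu : IsUnit (ν ^ Fintype.card ι * J.det) := by
    rw [← h.det_sq_mul]; exact (hg.pow 2).mul hJ
  exact (isUnit_pow_iff Fintype.card_ne_zero).mp (isUnit_of_mul_isUnit_left hu)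

/-- Change of frame: if `g` is a similitude of `J` and `Q P = 1` then `P g Q` is a similitude of
`Qᵀ J Q` with the same multiplier (for `Q = P⁻¹`: conjugation of `g`, congruence of `J`).
[folklore] -/
theorem IsSimilitude.conj [DecidableEq ι] {J g P Q : Matrix ι ι R} {ν : R} (h : IsSimilitude J ν g)
    (hQP : Q * P = 1) : IsSimilitude (Qᵀ * J * Q) ν (P * g * Q) := by
  unfold IsSimilitude at *
  have hT : Pᵀ * Qᵀ = 1 := by rw [← transpose_mul, hQP, transpose_one]
  calc (P * g * Q)ᵀ * (Qᵀ * J * Q) * (P * g * Q)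
      = Qᵀ * gᵀ * (Pᵀ * Qᵀ) * J * (Q * P * g * Q) := by
        simp only [transpose_mul, Matrix.mul_assoc]
    _ = Qᵀ * (gᵀ * J * g) * Q := by
        rw [hT, hQP, Matrix.mul_one, Matrix.one_mul]
        simp only [Matrix.mul_assoc]
    _ = ν • (Qᵀ * J * Q) := by rw [h, Matrix.mul_smul, Matrix.smul_mul]

/-- Similitudes are preserved by ring homomorphisms applied entrywise. [folklore] -/
theorem IsSimilitude.map {S : Type*} [CommRing S] (f : R →+* S) {J g : Matrix ι ι R} {ν : R}
    (h : IsSimilitude J ν g) : IsSimilitude (J.map f) (f ν) (g.map f) := by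
  unfold IsSimilitude at *
  rw [← transpose_map, ← Matrix.map_mul, ← Matrix.map_mul, h]
  ext i j
  simp

/-- Similitudes are preserved by re-indexing along an equivalence. [folklore] -/
theorem IsSimilitude.submatrix {κ : Type*} [Fintype κ] [DecidableEq κ] {J g : Matrix ι ι R}
    {ν : R} (h : IsSimilitude J ν g) (e : κ ≃ ι) :
    IsSimilitude (J.submatrix e e) ν (g.submatrix e e) := by
  unfold IsSimilitude at *
  rw [transpose_submatrix, submatrix_mul_equiv, submatrix_mul_equiv, h]
  ext i j
  simp

omit [Fintype ι] in
/-- Entries of a skew-symmetric matrix: `J i j = -J j i`. [folklore] -/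
theorem apply_eq_neg_apply_of_transpose_eq_neg {J : Matrix ι ι R} (hJt : Jᵀ = -J) (i j : ι) :
    J i j = -J j i := by
  simpa using congrFun (congrFun hJt j) i

/-- Congruence `Pᵀ J P` preserves skew-symmetry. [folklore] -/
theorem transpose_conj_transpose_eq_neg {J : Matrix ι ι R} (hJt : Jᵀ = -J) (P : Matrix ι ι R) :
    (Pᵀ * J * P)ᵀ = -(Pᵀ * J * P) := by
  rw [transpose_mul, transpose_mul, transpose_transpose, hJt, Matrix.neg_mul, Matrix.mul_neg,
    Matrix.mul_assoc]

/-- The quadratic form of an alternating matrix vanishes: `xᵀ J x = 0` (pair the `(i, j)` and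
`(j, i)` terms; the diagonal terms vanish). [folklore] -/
theorem sum_sum_mul_mul_eq_zero_of_alternating {J : Matrix ι ι R} (hJt : Jᵀ = -J)
    (hJd : ∀ i, J i i = 0) (x y : ι → R) (hxy : ∀ i j, x i * y j = x j * y i) :
    ∑ i, ∑ j, x i * J i j * y j = 0 := by
  rw [← Fintype.sum_prod_type']
  refine Finset.sum_ninvolution Prod.swap (fun p => ?_) (fun p hp => ?_)
    (fun p => Finset.mem_univ _) (fun p => Prod.swap_swap p)
  · obtain ⟨i, j⟩ := p
    show x i * J i j * y j + x j * J j i * y i = 0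
    rw [apply_eq_neg_apply_of_transpose_eq_neg hJt j i, mul_assoc (x j), neg_mul, mul_neg,
      ← mul_assoc, mul_right_comm (x j), ← hxy i j, mul_right_comm (x i)]
    ring
  · obtain ⟨i, j⟩ := p
    intro hij
    apply hp
    have : j = i := congrArg Prod.fst hij
    subst this
    show x j * J j j * y j = 0
    rw [hJd, mul_zero, zero_mul]

/-- Congruence `Pᵀ J P` preserves the zero diagonal of an alternating matrix. [folklore] -/
theorem conj_transpose_apply_self_eq_zero {J : Matrix ι ι R} (hJt : Jᵀ = -J)
    (hJd : ∀ i, J i i = 0) (P : Matrix ι ι R) (k : ι) : (Pᵀ * J * P) k k = 0 := by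
  simp only [Matrix.mul_apply, transpose_apply, Finset.sum_mul]
  rw [Finset.sum_comm]
  exact sum_sum_mul_mul_eq_zero_of_alternating hJt hJd (fun i => P i k) (fun i => P i k)
    (fun i j => mul_comm _ _)

/-- The bilinear form `Matrix.toBilin' J` of an alternating matrix is alternating. [folklore] -/
theorem isAlt_toBilin' [DecidableEq ι] {K : Type*} [CommRing K] {J : Matrix ι ι K} (hJt : Jᵀ = -J)
    (hJd : ∀ i, J i i = 0) : (Matrix.toBilin' J).IsAlt := by
  intro x
  change Matrix.toBilin' J x x = 0
  rw [Matrix.toBilin'_apply]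
  exact sum_sum_mul_mul_eq_zero_of_alternating hJt hJd x x (fun i j => mul_comm _ _)

end Similitude

/-! ### Symplectic bases and the determinant of a similitude (field case) -/

section SymplecticNormalForm

open Module

variable {K : Type*} [Field K]

/-- The induction behind the symplectic basis theorem (McDuff–Salamon, proof of Thm. 2.1.3): a
non-degenerate alternating form on a finite-dimensional space admits families `u, v` with
`dim = 2n`, `ω(uᵢ,uⱼ) = ω(vᵢ,vⱼ) = 0`, `ω(uᵢ,vⱼ) = δᵢⱼ` (split off a hyperbolic plane and recurse
on its orthogonal complement).  Private copy of
`Literature.Geometry.Symplectic.exists_symplectic_families` (whose file imports manifold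
theory). [cite: McDuffSalamon2017, Thm. 2.1.3] -/
private theorem exists_symplectic_families_aux' (d : ℕ) (W : Type*) [AddCommGroup W]
    [Module K W] [FiniteDimensional K W] (C : LinearMap.BilinForm K W) (hCa : C.IsAlt)
    (hCn : C.Nondegenerate) (hd : finrank K W ≤ d) :
    ∃ (n : ℕ) (u v : Fin n → W), finrank K W = 2 * n ∧
      (∀ i j, C (u i) (u j) = 0) ∧ (∀ i j, C (v i) (v j) = 0) ∧
      ∀ i j, C (u i) (v j) = if i = j then 1 else 0 := by
  induction d generalizing W with
  | zero =>
    exact ⟨0, Fin.elim0, Fin.elim0, by omega, fun i => i.elim0, fun i => i.elim0, fun i => i.elim0⟩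
  | succ d ih =>
    by_cases h0 : finrank K W = 0
    · exact ⟨0, Fin.elim0, Fin.elim0, by omega, fun i => i.elim0, fun i => i.elim0,
        fun i => i.elim0⟩
    -- a hyperbolic pair `u, v`
    obtain ⟨u, hu⟩ := (Module.finrank_pos_iff_exists_ne_zero (R := K) (M := W)).1
      (Nat.pos_of_ne_zero h0)
    obtain ⟨w, hw⟩ : ∃ w, C u w ≠ 0 := by
      by_contra h
      push Not at h
      exact hu (hCn.1 u h)
    set v : W := (C u w)⁻¹ • w with hv_def
    have hCrefl : C.IsRefl := hCa.isRefl
    have huv : C u v = 1 := by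
      rw [hv_def, LinearMap.BilinForm.smul_right, inv_mul_cancel₀ hw]
    have hvu : C v u = -1 := by rw [← hCa.neg_eq, huv]
    have huu : C u u = 0 := hCa u
    have hvv : C v v = 0 := hCa v
    -- the plane `P` they span
    let P : Submodule K W := Submodule.span K (Set.range ![u, v])
    have huP : u ∈ P := Submodule.subset_span ⟨0, rfl⟩
    have hvP : v ∈ P := Submodule.subset_span ⟨1, rfl⟩
    have hmemP : ∀ x ∈ P, ∃ a b : K, x = a • u + b • v := by
      intro x hx
      obtain ⟨c, rfl⟩ := (Submodule.mem_span_range_iff_exists_fun K).1 hx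
      exact ⟨c 0, c 1, by simp [Fin.sum_univ_two]⟩
    -- `C|P` is nondegenerate, so `W = P ⊕ Pᗮ` and `C|Pᗮ` is nondegenerate
    have hPa : (C.restrict P).IsAlt := fun x => hCa (x : W)
    have hPnd : (C.restrict P).Nondegenerate := by
      refine hPa.isRefl.nondegenerate_iff_separatingLeft.2 ?_
      intro x hx
      obtain ⟨a, b, hab⟩ := hmemP x x.2
      have h1 := hx ⟨v, hvP⟩
      have h2 := hx ⟨u, huP⟩
      change C (x : W) v = 0 at h1
      change C (x : W) u = 0 at h2
      rw [hab, LinearMap.BilinForm.add_left, LinearMap.BilinForm.smul_left,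
        LinearMap.BilinForm.smul_left, huv, hvv] at h1
      rw [hab, LinearMap.BilinForm.add_left, LinearMap.BilinForm.smul_left,
        LinearMap.BilinForm.smul_left, huu, hvu] at h2
      have ha : a = 0 := by simpa using h1
      have hb : b = 0 := by simpa using h2
      ext
      simp [hab, ha, hb]
    have hcompl : IsCompl P (C.orthogonal P) :=
      LinearMap.BilinForm.isCompl_orthogonal_of_restrict_nondegenerate hCrefl hPnd
    have hQnd : (C.restrict (C.orthogonal P)).Nondegenerate := by
      rw [LinearMap.BilinForm.restrict_nondegenerate_iff_isCompl_orthogonal hCrefl,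
        LinearMap.BilinForm.orthogonal_orthogonal hCn hCrefl]
      exact hcompl.symm
    have hQa : (C.restrict (C.orthogonal P)).IsAlt := fun x => hCa (x : W)
    -- dimensions
    have hli : LinearIndependent K ![u, v] := by
      rw [LinearIndependent.pair_iff]
      intro s t hst
      have h1 := congrArg (fun z => C z v) hst
      have h2 := congrArg (fun z => C z u) hst
      simp only [LinearMap.BilinForm.add_left, LinearMap.BilinForm.smul_left, huv, hvv, huu,
        hvu, map_zero, LinearMap.zero_apply] at h1 h2
      exact ⟨by simpa using h1, by simpa using h2⟩
    have hPrank : finrank K P = 2 := by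
      simpa using finrank_span_eq_card hli
    have hQrank : finrank K (C.orthogonal P) + 2 = finrank K W := by
      have := Submodule.finrank_add_eq_of_isCompl hcompl
      omega
    -- induction hypothesis on `Pᗮ`
    obtain ⟨m, u', v', hQm, huu', hvv', huv'⟩ :=
      ih (C.orthogonal P) (C.restrict (C.orthogonal P)) hQa hQnd (by omega)
    have hQmem : ∀ q ∈ C.orthogonal P, ∀ p ∈ P, C p q = 0 := fun q hq p hp =>
      (LinearMap.BilinForm.mem_orthogonal_iff.1 hq) p hp
    refine ⟨m + 1, Fin.cons u (fun i => (u' i : W)), Fin.cons v (fun i => (v' i : W)), by omega,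
      ?_, ?_, ?_⟩
    · intro i j
      refine Fin.cases ?_ (fun i => ?_) i <;> refine Fin.cases ?_ (fun j => ?_) j
      · simpa using huu
      · simpa using hQmem _ (u' j).2 u huP
      · simpa using hCrefl _ _ (hQmem _ (u' i).2 u huP)
      · simpa using huu' i j
    · intro i j
      refine Fin.cases ?_ (fun i => ?_) i <;> refine Fin.cases ?_ (fun j => ?_) j
      · simpa using hvv
      · simpa using hQmem _ (v' j).2 v hvP
      · simpa using hCrefl _ _ (hQmem _ (v' i).2 v hvP)
      · simpa using hvv' i j
    · intro i j
      refine Fin.cases ?_ (fun i => ?_) i <;> refine Fin.cases ?_ (fun j => ?_) j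
      · simpa using huv
      · rw [if_neg (Fin.succ_ne_zero j).symm]
        simpa using hQmem _ (v' j).2 u huP
      · rw [if_neg (Fin.succ_ne_zero i)]
        simpa using hCrefl _ _ (hQmem _ (u' i).2 v hvP)
      · simpa [Fin.succ_inj] using huv' i j

/-- **A non-degenerate alternating matrix has even size** (over a field): the underlying space
carries a symplectic basis. [cite: McDuffSalamon2017, Thm. 2.1.3] -/
theorem even_card_of_alternating {ι : Type*} [Fintype ι] [DecidableEq ι] {J : Matrix ι ι K}
    (hJ : J.det ≠ 0) (hJt : Jᵀ = -J) (hJd : ∀ i, J i i = 0) : Even (Fintype.card ι) := by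
  obtain ⟨m, -, -, hdim, -⟩ := exists_symplectic_families_aux' _ (ι → K) (Matrix.toBilin' J)
    (isAlt_toBilin' hJt hJd) (LinearMap.BilinForm.nondegenerate_toBilin'_of_det_ne_zero' J hJ)
    le_rfl
  rw [Module.finrank_fintype_fun_eq_card] at hdim
  exact ⟨m, by omega⟩

/-- `Fin n` version of `even_card_of_alternating`. [cite: McDuffSalamon2017, Thm. 2.1.3] -/
theorem even_of_alternating {n : ℕ} {J : Matrix (Fin n) (Fin n) K} (hJ : J.det ≠ 0)
    (hJt : Jᵀ = -J) (hJd : ∀ i, J i i = 0) : Even n := by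
  simpa using even_card_of_alternating hJ hJt hJd

/-- **Symplectic normal form of a non-degenerate alternating matrix** on `Fin m ⊕ Fin m` (over a
field): `Pᵀ J P = -J₀` for some invertible `P`, where `J₀ = Matrix.J (Fin m) K` is Mathlib's
standard alternating matrix `[[0, -1], [1, 0]]` (so `-J₀ = [[0, 1], [-1, 0]]` is the Gram matrix
of a symplectic basis `u₁, …, uₘ, v₁, …, vₘ`). [cite: McDuffSalamon2017, Thm. 2.1.3] -/
theorem exists_transpose_mul_mul_eq_neg_J {m : ℕ}
    {J : Matrix (Fin m ⊕ Fin m) (Fin m ⊕ Fin m) K} (hJ : J.det ≠ 0) (hJt : Jᵀ = -J)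
    (hJd : ∀ i, J i i = 0) :
    ∃ P : Matrix (Fin m ⊕ Fin m) (Fin m ⊕ Fin m) K, P.det ≠ 0 ∧
      Pᵀ * J * P = -Matrix.J (Fin m) K := by
  set B : LinearMap.BilinForm K (Fin m ⊕ Fin m → K) := Matrix.toBilin' J with hB
  have hBa : B.IsAlt := isAlt_toBilin' hJt hJd
  have hBn : B.Nondegenerate := LinearMap.BilinForm.nondegenerate_toBilin'_of_det_ne_zero' J hJ
  obtain ⟨m', u, v, hdim, huu, hvv, huv⟩ := exists_symplectic_families_aux' _ _ B hBa hBn le_rfl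
  have hm : m' = m := by
    rw [Module.finrank_fintype_fun_eq_card, Fintype.card_sum, Fintype.card_fin] at hdim
    omega
  subst hm
  -- the change-of-basis matrix: columns are the symplectic basis vectors
  let w : Fin m' ⊕ Fin m' → (Fin m' ⊕ Fin m' → K) := Sum.elim u v
  let P : Matrix (Fin m' ⊕ Fin m') (Fin m' ⊕ Fin m') K := Matrix.of fun i k => w k i
  have hP : Pᵀ * J * P = Matrix.of fun k l => B (w k) (w l) := by
    ext k l
    simp only [hB, Matrix.toBilin'_apply, Matrix.mul_apply, transpose_apply, Matrix.of_apply,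
      Finset.sum_mul, P]
    exact Finset.sum_comm
  have hG : (Matrix.of fun k l => B (w k) (w l)) = -Matrix.J (Fin m') K := by
    ext k l
    rcases k with i | i <;> rcases l with j | j
    · simp [w, Matrix.J, huu]
    · simp [w, Matrix.J, huv, Matrix.one_apply]
    · have hvu : B (v i) (u j) = -B (u j) (v i) := (hBa.neg_eq (u j) (v i)).symm
      by_cases hij : i = j
      · subst hij
        simp [w, Matrix.J, hvu, huv]
      · simp [w, Matrix.J, hvu, huv, hij, Ne.symm hij]
    · simp [w, Matrix.J, hvv]
  refine ⟨P, ?_, hP.trans hG⟩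
  intro hP0
  have h1 := congrArg Matrix.det (hP.trans hG)
  rw [det_mul, det_mul, hP0, mul_zero, det_neg] at h1
  exact ((isUnit_one.neg.pow _).mul (Matrix.isUnit_det_J (Fin m') K)).ne_zero h1.symm

/-- **Determinant of a similitude of the standard form** (any commutative ring): if
`gᵀ J₀ g = ν J₀` with `J₀ = Matrix.J l R` and `ν ∈ Rˣ`, then `det g = ν ^ |l|`.  Proof: for
`D = diag(1, ν⁻¹)` one has `Dᵀ J₀ D = ν⁻¹ J₀`, so `g D ∈ Sp(J₀)` has determinant `1`
(Mathlib `SymplecticGroup.det_eq_one`), and `det D = ν⁻ᵐ`. [folklore] -/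
theorem det_eq_pow_of_isSimilitude_J {l : Type*} [Fintype l] [DecidableEq l] {R : Type*}
    [CommRing R] {g : Matrix (l ⊕ l) (l ⊕ l) R} {ν : R} (hν : IsUnit ν)
    (h : gᵀ * Matrix.J l R * g = ν • Matrix.J l R) : g.det = ν ^ Fintype.card l := by
  obtain ⟨u, rfl⟩ := hν
  let D : Matrix (l ⊕ l) (l ⊕ l) R := Matrix.fromBlocks 1 0 0 ((↑u⁻¹ : R) • 1)
  have hD : Dᵀ * Matrix.J l R * D = (↑u⁻¹ : R) • Matrix.J l R := by
    simp [D, Matrix.J, Matrix.fromBlocks_transpose, Matrix.fromBlocks_multiply,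
      Matrix.fromBlocks_smul]
  have hdetD : D.det = (↑u⁻¹ : R) ^ Fintype.card l := by
    simp [D]
  have hmem : g * D ∈ Matrix.symplecticGroup l R := by
    rw [SymplecticGroup.mem_iff']
    calc (g * D)ᵀ * Matrix.J l R * (g * D) = Dᵀ * (gᵀ * Matrix.J l R * g) * D := by
          rw [transpose_mul]; simp only [Matrix.mul_assoc]
      _ = Matrix.J l R := by
          rw [h, Matrix.mul_smul, Matrix.smul_mul, hD, smul_smul, Units.mul_inv, one_smul]
  have h1 := SymplecticGroup.det_eq_one hmem
  rw [det_mul, hdetD] at h1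
  calc g.det = g.det * ((↑u⁻¹ : R) ^ Fintype.card l * (↑u : R) ^ Fintype.card l) := by
        rw [← mul_pow, Units.inv_mul, one_pow, mul_one]
    _ = (↑u : R) ^ Fintype.card l := by rw [← mul_assoc, h1, one_mul]

/-- **Determinant of a similitude, index `Fin m ⊕ Fin m`** (over a field, `J` any non-degenerate
alternating matrix): `gᵀ J g = ν J → det g = ν ^ m`. [folklore] -/
theorem det_eq_pow_of_alternating_sum {m : ℕ} {J g : Matrix (Fin m ⊕ Fin m) (Fin m ⊕ Fin m) K}
    {ν : K} (hJ : J.det ≠ 0) (hJt : Jᵀ = -J) (hJd : ∀ i, J i i = 0)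
    (h : gᵀ * J * g = ν • J) : g.det = ν ^ m := by
  obtain ⟨P, hP, hPJP⟩ := exists_transpose_mul_mul_eq_neg_J hJ hJt hJd
  have hPu : IsUnit P.det := isUnit_iff_ne_zero.mpr hP
  -- conjugate `g` into a similitude of the standard form
  have key : (P⁻¹ * g * P)ᵀ * (Pᵀ * J * P) * (P⁻¹ * g * P) = ν • (Pᵀ * J * P) := by
    have hT : (P⁻¹)ᵀ * Pᵀ = 1 := by
      rw [← transpose_mul, Matrix.mul_nonsing_inv _ hPu, transpose_one]
    calc (P⁻¹ * g * P)ᵀ * (Pᵀ * J * P) * (P⁻¹ * g * P)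
        = Pᵀ * gᵀ * ((P⁻¹)ᵀ * Pᵀ) * J * (P * P⁻¹ * g * P) := by
          simp only [transpose_mul, Matrix.mul_assoc]
      _ = Pᵀ * (gᵀ * J * g) * P := by
          rw [hT, Matrix.mul_nonsing_inv _ hPu, Matrix.mul_one, Matrix.one_mul]
          simp only [Matrix.mul_assoc]
      _ = ν • (Pᵀ * J * P) := by rw [h, Matrix.mul_smul, Matrix.smul_mul]
  have h' : (P⁻¹ * g * P)ᵀ * Matrix.J (Fin m) K * (P⁻¹ * g * P) = ν • Matrix.J (Fin m) K := by
    have hJ0 : Matrix.J (Fin m) K = -(Pᵀ * J * P) := by rw [hPJP, neg_neg]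
    rw [hJ0, Matrix.mul_neg, Matrix.neg_mul, key, smul_neg]
  have hdet : (P⁻¹ * g * P).det = g.det :=
    Matrix.det_conj' ((Matrix.isUnit_iff_isUnit_det P).mpr hPu) g
  rw [← hdet]
  rcases Nat.eq_zero_or_pos m with rfl | hm
  · rw [pow_zero]; exact det_isEmpty
  by_cases hν : ν = 0
  · subst hν
    have h2 := IsSimilitude.det_sq_mul (J := Matrix.J (Fin m) K) (ν := (0 : K)) h'
    have hc : Fintype.card (Fin m ⊕ Fin m) ≠ 0 := by simp; omega
    rw [zero_pow hc, zero_mul, mul_eq_zero, or_iff_left (Matrix.isUnit_det_J (Fin m) K).ne_zero]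
      at h2
    rw [(pow_eq_zero_iff two_ne_zero).mp h2, zero_pow hm.ne']
  · rw [det_eq_pow_of_isSimilitude_J (isUnit_iff_ne_zero.mpr hν) h', Fintype.card_fin]

/-- **Determinant of a symplectic similitude** (over a field): if `J ∈ M_n(K)` is alternating
with `det J ≠ 0` and `gᵀ J g = ν J`, then `det g = ν ^ (n / 2)` (and `n` is even,
`even_of_alternating`).  For `n = 4`: `det = ν²` on `GSp_4`; for `n = 6`: `det = ν³`.
[folklore] -/
theorem det_eq_pow_of_alternating {n : ℕ} {J g : Matrix (Fin n) (Fin n) K} {ν : K}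
    (hJ : J.det ≠ 0) (hJt : Jᵀ = -J) (hJd : ∀ i, J i i = 0) (h : gᵀ * J * g = ν • J) :
    g.det = ν ^ (n / 2) := by
  obtain ⟨m, hm⟩ := even_of_alternating hJ hJt hJd
  subst hm
  have hd : (m + m) / 2 = m := by omega
  rw [hd]
  let e : Fin m ⊕ Fin m ≃ Fin (m + m) := finSumFinEquiv
  have h' : IsSimilitude (J.submatrix e e) ν (g.submatrix e e) := IsSimilitude.submatrix h e
  have hJ' : (J.submatrix e e).det ≠ 0 := by rwa [det_submatrix_equiv_self]
  have hJt' : (J.submatrix e e)ᵀ = -J.submatrix e e := by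
    rw [transpose_submatrix, hJt]
    ext i j
    simp
  have hJd' : ∀ i, J.submatrix e e i i = 0 := fun i => hJd (e i)
  rw [← det_submatrix_equiv_self e g]
  exact det_eq_pow_of_alternating_sum hJ' hJt' hJd' h'

end SymplecticNormalForm

/-! ### `GSp`-valued framed representations -/

section Framed

variable {G : Type*} [Group G] [TopologicalSpace G] {A : Type*} [CommRing A] [TopologicalSpace A]
  {n : ℕ}

/-- A framed representation `ρ : G →ₜ* GL_n(A)` is **`GSp`-valued** (takes values in a general
symplectic group) if there are an *alternating* matrix `J ∈ M_n(A)` (`Jᵀ = -J` with zero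
diagonal — the Gram matrix of an alternating pairing `⟨x, y⟩ = xᵀ J y` on `Aⁿ`) with
`det J ∈ Aˣ` (the pairing is perfect) and a function `ν : G → A` (the **multiplier**, or
similitude factor) such that `ρ(g)ᵀ J ρ(g) = ν(g) J`, i.e. `⟨ρ(g) x, ρ(g) y⟩ = ν(g) ⟨x, y⟩`, for
all `g ∈ G`: `ρ` factors through `GSp(J) = {g ∈ GL_n : gᵀ J g = ν(g) J}`
([BoxerEtAl2021, §2.1.1] defines `GSp_4(R) = {g ∈ GL_4(R) : g J gᵗ = ν(g) J}` with `ν` the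
similitude factor, a homomorphism `GSp_4 → 𝔾_m`; the transposed convention defines the same
class of representations, `gᵀ J g = ν J ↔ g J⁻¹ gᵀ = ν J⁻¹`).  The multiplier is then unique,
unit-valued, multiplicative and continuous (`FramedRep.IsGSpValued.exists_continuousMonoidHom`),
`n` is even and `det ρ = ν ^ (n/2)` over a field (`FramedRep.IsGSpValued.det_eq_pow`).
Examples: `H¹` of an abelian surface with the Weil pairing (`n = 4`, `ν = ε⁻¹`), `H³` of a
Calabi–Yau threefold with the cup product (`ν = ε⁻³`). [cite: BoxerEtAl2021, §2.1.1] -/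
def FramedRep.IsGSpValued (ρ : FramedRep G A n) : Prop :=
  ∃ J : Matrix (Fin n) (Fin n) A, IsUnit J.det ∧ Jᵀ = -J ∧ (∀ i, J i i = 0) ∧
    ∃ ν : G → A, ∀ g, (ρ g : Matrix (Fin n) (Fin n) A)ᵀ * J * (ρ g : Matrix (Fin n) (Fin n) A) =
      ν g • J

/-- Unfolding lemma for `FramedRep.IsGSpValued`. [cite: BoxerEtAl2021, §2.1.1] -/
theorem FramedRep.isGSpValued_iff (ρ : FramedRep G A n) :
    ρ.IsGSpValued ↔ ∃ J : Matrix (Fin n) (Fin n) A, IsUnit J.det ∧ Jᵀ = -J ∧ (∀ i, J i i = 0) ∧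
      ∃ ν : G → A, ∀ g, IsSimilitude J (ν g) (ρ g : Matrix (Fin n) (Fin n) A) :=
  Iff.rfl

/-- Over a field of characteristic `≠ 2` the diagonal clause is automatic and `IsUnit (det J)`
is `det J ≠ 0`: this is the literal shape in which route `GSpinRung` inlines the notion.
[cite: BoxerEtAl2021, §2.1.1] -/
theorem FramedRep.isGSpValued_iff_det_ne_zero {K : Type*} [Field K] [TopologicalSpace K]
    [NeZero (2 : K)] (ρ : FramedRep G K n) :
    ρ.IsGSpValued ↔ ∃ J : Matrix (Fin n) (Fin n) K, J.det ≠ 0 ∧ Jᵀ = -J ∧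
      ∃ ν : G → K, ∀ g, (ρ g : Matrix (Fin n) (Fin n) K)ᵀ * J * (ρ g : Matrix (Fin n) (Fin n) K) =
        ν g • J := by
  constructor
  · rintro ⟨J, hJ, hJt, -, ν, hν⟩
    exact ⟨J, hJ.ne_zero, hJt, ν, hν⟩
  · rintro ⟨J, hJ, hJt, ν, hν⟩
    refine ⟨J, isUnit_iff_ne_zero.mpr hJ, hJt, fun i => ?_, ν, hν⟩
    have h := apply_eq_neg_apply_of_transpose_eq_neg hJt i i
    have h2 : (2 : K) * J i i = 0 := by rw [two_mul]; nth_rw 1 [h]; rw [neg_add_cancel]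
    exact (mul_eq_zero.mp h2).resolve_left two_ne_zero

/-- **`GL_2 = GSp_2`**: every framed representation of rank `2` is `GSp`-valued, for
`J = [[0, 1], [-1, 0]]` and multiplier `det ρ` (`gᵀ J g = det(g) J` for `2 × 2` matrices).
Non-vacuity witness for `FramedRep.IsGSpValued`. [folklore] -/
theorem FramedRep.isGSpValued_two (ρ : FramedRep G A 2) : ρ.IsGSpValued := by
  refine ⟨!![0, 1; -1, 0], ?_, ?_, ?_, fun g => (ρ g : Matrix (Fin 2) (Fin 2) A).det, fun g => ?_⟩
  · simp [Matrix.det_fin_two_of]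
  · ext i j
    fin_cases i <;> fin_cases j <;> simp
  · intro i
    fin_cases i <;> simp
  · ext i j
    fin_cases i <;> fin_cases j <;>
      simp [Matrix.mul_apply, Fin.sum_univ_two, Matrix.det_fin_two] <;> ring

/-- **Change of frame**: `GSp`-valuedness is invariant under `FramedRep.conj` (conjugate `ρ` by
`P`, replace `J` by `P⁻ᵀ J P⁻¹`, keep `ν`). [folklore] -/
theorem FramedRep.IsGSpValued.conj [IsTopologicalRing A] {ρ : FramedRep G A n}
    (h : ρ.IsGSpValued) (P : GL (Fin n) A) : (ρ.conj P).IsGSpValued := by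
  obtain ⟨J, hJ, hJt, hJd, ν, hν⟩ := h
  refine ⟨((P⁻¹ : GL (Fin n) A) : Matrix (Fin n) (Fin n) A)ᵀ * J *
      ((P⁻¹ : GL (Fin n) A) : Matrix (Fin n) (Fin n) A), ?_, transpose_conj_transpose_eq_neg hJt _,
    conj_transpose_apply_self_eq_zero hJt hJd _, ν, fun g => ?_⟩
  · rw [det_mul, det_mul, det_transpose]
    exact ((Matrix.isUnits_det_units P⁻¹).mul hJ).mul (Matrix.isUnits_det_units P⁻¹)
  · rw [FramedRep.conj_apply, Units.val_mul, Units.val_mul]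
    exact IsSimilitude.conj (hν g) (Units.inv_mul P)

/-- `GSp`-valuedness is preserved by composition with a continuous homomorphism `H →ₜ* G`
(same `J`, multiplier `ν ∘ f`). [folklore] -/
theorem FramedRep.IsGSpValued.comp {H : Type*} [Group H] [TopologicalSpace H] {ρ : FramedRep G A n}
    (h : ρ.IsGSpValued) (f : H →ₜ* G) : FramedRep.IsGSpValued (ρ.comp f) := by
  obtain ⟨J, hJ, hJt, hJd, ν, hν⟩ := h
  exact ⟨J, hJ, hJt, hJd, ν ∘ f, fun x => hν (f x)⟩

/-- **Restriction to `Γ_L`**: if `ρ : Γ_K → GL_n(A)` is `GSp`-valued then so is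
`ρ|_{Γ_L} = FramedGaloisRep.restrictField L ρ` (same `J`, multiplier restricted). [folklore] -/
theorem FramedGaloisRep.IsGSpValued.restrictField {K : Type*} [Field K] {ρ : FramedGaloisRep K A n}
    (h : FramedRep.IsGSpValued ρ) (L : Type*) [Field L] [Algebra K L] :
    FramedRep.IsGSpValued (ρ.restrictField L) := by
  obtain ⟨J, hJ, hJt, hJd, ν, hν⟩ := h
  exact ⟨J, hJ, hJt, hJd, fun σ => ν (absGaloisRestrict K L σ), fun σ => by
    rw [FramedGaloisRep.restrictField_apply]; exact hν _⟩

/-- **Base change** along a continuous ring homomorphism `f : A →+* B` preserves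
`GSp`-valuedness (`J ↦ f(J)`, `ν ↦ f ∘ ν`). [folklore] -/
theorem FramedRep.IsGSpValued.baseChange {B : Type*} [CommRing B] [TopologicalSpace B]
    {ρ : FramedRep G A n} (h : ρ.IsGSpValued) (f : A →+* B) (hf : Continuous f) :
    (ρ.baseChange f hf).IsGSpValued := by
  obtain ⟨J, hJ, hJt, hJd, ν, hν⟩ := h
  refine ⟨J.map f, ?_, ?_, fun i => ?_, fun g => f (ν g), fun g => ?_⟩
  · have := hJ.map f
    rwa [RingHom.map_det, RingHom.mapMatrix_apply] at this
  · rw [← transpose_map, hJt]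
    ext i j
    simp
  · simp [hJd i]
  · rw [FramedRep.baseChange_apply]
    exact IsSimilitude.map f (hν g)

section Multiplier

variable {ρ : FramedRep G A n} {J : Matrix (Fin n) (Fin n) A} {ν : G → A}

/-- The multiplier of a `GSp`-valued representation is multiplicative (`n ≥ 1`).
[cite: BoxerEtAl2021, §2.1.1] -/
theorem FramedRep.multiplier_mul [NeZero n] (hJ : IsUnit J.det)
    (hν : ∀ g, (ρ g : Matrix (Fin n) (Fin n) A)ᵀ * J * (ρ g : Matrix (Fin n) (Fin n) A) = ν g • J)
    (g h : G) : ν (g * h) = ν g * ν h := by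
  have h1 : IsSimilitude J (ν (g * h))
      ((ρ g : Matrix (Fin n) (Fin n) A) * (ρ h : Matrix (Fin n) (Fin n) A)) := by
    have := hν (g * h)
    rwa [map_mul, Units.val_mul] at this
  exact IsSimilitude.multiplier_eq hJ h1 (IsSimilitude.mul (hν g) (hν h))

/-- The multiplier of a `GSp`-valued representation is `1` at the identity (`n ≥ 1`).
[cite: BoxerEtAl2021, §2.1.1] -/
theorem FramedRep.multiplier_one [NeZero n] (hJ : IsUnit J.det)
    (hν : ∀ g, (ρ g : Matrix (Fin n) (Fin n) A)ᵀ * J * (ρ g : Matrix (Fin n) (Fin n) A) = ν g • J) :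
    ν 1 = 1 := by
  have h1 : IsSimilitude J (ν 1) 1 := by
    have := hν 1
    rwa [map_one, Units.val_one] at this
  exact IsSimilitude.multiplier_eq hJ h1 (IsSimilitude.one J)

/-- The multiplier of a `GSp`-valued representation is unit-valued (`n ≥ 1`).
[cite: BoxerEtAl2021, §2.1.1] -/
theorem FramedRep.isUnit_multiplier [NeZero n] (hJ : IsUnit J.det)
    (hν : ∀ g, (ρ g : Matrix (Fin n) (Fin n) A)ᵀ * J * (ρ g : Matrix (Fin n) (Fin n) A) = ν g • J)
    (g : G) : IsUnit (ν g) :=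
  IsSimilitude.isUnit_multiplier hJ (Matrix.isUnits_det_units (ρ g)) (hν g)

/-- The multiplier as a matrix entry: `ν(g) = (ρ(g)ᵀ J ρ(g) J⁻¹)ᵢᵢ` (so it is continuous in
`g`). [folklore] -/
theorem FramedRep.multiplier_eq_entry (hJ : IsUnit J.det)
    (hν : ∀ g, (ρ g : Matrix (Fin n) (Fin n) A)ᵀ * J * (ρ g : Matrix (Fin n) (Fin n) A) = ν g • J)
    (g : G) (i : Fin n) :
    ν g = ((ρ g : Matrix (Fin n) (Fin n) A)ᵀ * J * (ρ g : Matrix (Fin n) (Fin n) A) * J⁻¹) i i := by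
  rw [hν g, Matrix.smul_mul, Matrix.mul_nonsing_inv _ hJ]
  simp

/-- In every dimension `det ρ(g) ^ 2 = ν(g) ^ n`. [folklore] -/
theorem FramedRep.det_sq_eq_multiplier_pow (hJ : IsUnit J.det)
    (hν : ∀ g, (ρ g : Matrix (Fin n) (Fin n) A)ᵀ * J * (ρ g : Matrix (Fin n) (Fin n) A) = ν g • J)
    (g : G) : (ρ g : Matrix (Fin n) (Fin n) A).det ^ 2 = ν g ^ n := by
  simpa using IsSimilitude.det_sq hJ (hν g)

end Multiplier

/-- **The multiplier is a continuous character.**  If `ρ` is `GSp`-valued then the multiplier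
can be taken to be a continuous homomorphism `χ : G →ₜ* Aˣ` (for `n ≥ 1` it is forced:
`ν(gh) J = ρ(h)ᵀ (ν(g) J) ρ(h) = ν(g) ν(h) J`, `ν(g)ⁿ det J = det(ρ g)² det J`, and
`ν(g) = (ρ(g)ᵀ J ρ(g) J⁻¹)₁₁` is continuous; for `n = 0` take `χ = 1`).
[cite: BoxerEtAl2021, §2.1.1] -/
theorem FramedRep.IsGSpValued.exists_continuousMonoidHom [IsTopologicalRing A]
    {ρ : FramedRep G A n} (h : ρ.IsGSpValued) :
    ∃ (J : Matrix (Fin n) (Fin n) A) (χ : G →ₜ* Aˣ), IsUnit J.det ∧ Jᵀ = -J ∧ (∀ i, J i i = 0) ∧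
      ∀ g, (ρ g : Matrix (Fin n) (Fin n) A)ᵀ * J * (ρ g : Matrix (Fin n) (Fin n) A) =
        (χ g : A) • J := by
  obtain ⟨J, hJ, hJt, hJd, ν, hν⟩ := h
  rcases Nat.eq_zero_or_pos n with rfl | hn
  · exact ⟨J, 1, hJ, hJt, hJd, fun g => Subsingleton.elim _ _⟩
  haveI : NeZero n := ⟨hn.ne'⟩
  have hunit : ∀ g, IsUnit (ν g) := FramedRep.isUnit_multiplier hJ hν
  let χ₀ : G →* Aˣ :=
    { toFun := fun g => (hunit g).unit
      map_one' := Units.ext (by simp [FramedRep.multiplier_one hJ hν])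
      map_mul' := fun g g' => Units.ext (by simp [FramedRep.multiplier_mul hJ hν]) }
  have hχ₀ : ∀ g, (χ₀ g : A) = ν g := fun g => (hunit g).unit_spec
  have hρc : Continuous fun g => (ρ g : Matrix (Fin n) (Fin n) A) :=
    Units.continuous_val.comp (map_continuous ρ)
  have hρi : Continuous fun g => (((ρ g)⁻¹ : GL (Fin n) A) : Matrix (Fin n) (Fin n) A) :=
    Units.continuous_coe_inv.comp (map_continuous ρ)
  let i : Fin n := ⟨0, hn⟩
  have hcont : Continuous χ₀ := by
    refine Units.continuous_iff.mpr ⟨?_, ?_⟩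
    · have heq : (Units.val ∘ χ₀) = fun g =>
          ((ρ g : Matrix (Fin n) (Fin n) A)ᵀ * J * (ρ g : Matrix (Fin n) (Fin n) A) * J⁻¹) i i := by
        funext g
        rw [Function.comp_apply, hχ₀, FramedRep.multiplier_eq_entry hJ hν g i]
      rw [heq]
      exact (((hρc.matrix_transpose.matrix_mul continuous_const).matrix_mul hρc).matrix_mul
        continuous_const).matrix_elem i i
    · have heq : (fun g => ((χ₀ g)⁻¹ : Aˣ).val) = fun g =>
          ((((ρ g)⁻¹ : GL (Fin n) A) : Matrix (Fin n) (Fin n) A)ᵀ * J *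
            (((ρ g)⁻¹ : GL (Fin n) A) : Matrix (Fin n) (Fin n) A) * J⁻¹) i i := by
        funext g
        rw [← map_inv χ₀ g, hχ₀, FramedRep.multiplier_eq_entry hJ hν g⁻¹ i, map_inv ρ g]
      rw [heq]
      exact (((hρi.matrix_transpose.matrix_mul continuous_const).matrix_mul hρi).matrix_mul
        continuous_const).matrix_elem i i
  exact ⟨J, { toMonoidHom := χ₀, continuous_toFun := hcont }, hJ, hJt, hJd, fun g => by
    rw [hν g]; exact congrArg (· • J) (hχ₀ g).symm⟩

/-! ### Determinant and oddness -/

section Field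

variable {K : Type*} [Field K] [TopologicalSpace K]

/-- A `GSp`-valued representation over a field has even dimension.
[cite: McDuffSalamon2017, Thm. 2.1.3] -/
theorem FramedRep.IsGSpValued.even {ρ : FramedRep G K n} (h : ρ.IsGSpValued) : Even n := by
  obtain ⟨J, hJ, hJt, hJd, -, -⟩ := h
  exact even_of_alternating hJ.ne_zero hJt hJd

/-- **`det ρ = ν ^ (n/2)`** for a `GSp`-valued representation over a field: `det ρ(g) = ν(g)²` for
`GSp_4`, `ν(g)³` for `GSp_6`. [folklore] -/
theorem FramedRep.det_eq_multiplier_pow (ρ : FramedRep G K n) {J : Matrix (Fin n) (Fin n) K}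
    {ν : G → K} (hJ : J.det ≠ 0) (hJt : Jᵀ = -J) (hJd : ∀ i, J i i = 0)
    (hν : ∀ g, (ρ g : Matrix (Fin n) (Fin n) K)ᵀ * J * (ρ g : Matrix (Fin n) (Fin n) K) = ν g • J)
    (g : G) : ((Matrix.GeneralLinearGroup.det (ρ g) : Kˣ) : K) = ν g ^ (n / 2) := by
  rw [Matrix.GeneralLinearGroup.val_det_apply]
  exact det_eq_pow_of_alternating hJ hJt hJd (hν g)

/-- Existential form of `FramedRep.det_eq_multiplier_pow`. [folklore] -/
theorem FramedRep.IsGSpValued.det_eq_pow {ρ : FramedRep G K n} (h : ρ.IsGSpValued) :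
    ∃ (J : Matrix (Fin n) (Fin n) K) (ν : G → K), J.det ≠ 0 ∧ Jᵀ = -J ∧ (∀ i, J i i = 0) ∧
      (∀ g, (ρ g : Matrix (Fin n) (Fin n) K)ᵀ * J * (ρ g : Matrix (Fin n) (Fin n) K) = ν g • J) ∧
      ∀ g, ((Matrix.GeneralLinearGroup.det (ρ g) : Kˣ) : K) = ν g ^ (n / 2) := by
  obtain ⟨J, hJ, hJt, hJd, ν, hν⟩ := h
  exact ⟨J, ν, hJ.ne_zero, hJt, hJd, hν,
    FramedRep.det_eq_multiplier_pow ρ hJ.ne_zero hJt hJd hν⟩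

variable {F : Type*} [Field F]

/-- The multiplier of a complex conjugation is a square root of `1` (`n ≥ 1`): `c² = 1`.
[folklore] -/
theorem FramedGaloisRep.multiplier_sq_eq_one [NeZero n] {ρ : FramedGaloisRep F A n}
    {J : Matrix (Fin n) (Fin n) A} {ν : Field.absoluteGaloisGroup F → A} (hJ : IsUnit J.det)
    (hν : ∀ σ, (ρ σ : Matrix (Fin n) (Fin n) A)ᵀ * J * (ρ σ : Matrix (Fin n) (Fin n) A) = ν σ • J)
    {φ : F →+* ℝ} {c : Field.absoluteGaloisGroup F} (hc : IsComplexConjugation φ c) :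
    ν c ^ 2 = 1 := by
  rw [sq, ← FramedRep.multiplier_mul hJ hν, ← sq, hc.sq_eq_one, FramedRep.multiplier_one hJ hν]

/-- **Odd `GSp_{2m}`-valued representations, `m` odd** (e.g. `GSp_6`, `GSp_2 = GL_2`): for
`ρ : Γ_F → GSp_n(K)` with multiplier `ν` over a field `K` and `n / 2` odd,
`det ρ(c) = ν(c)^{n/2} = ν(c)` for every complex conjugation `c` (as `ν(c) = ±1`), so
`FramedGaloisRep.IsOdd ρ` (`det ρ(c) = -1`) is equivalent to the oddness of the similitude
character, `ν(c) = -1` for all complex conjugations — the condition "`ρ̄` is odd if the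
similitude character `ψ` is odd, i.e. `ψ(c_v) = -1` for each `v ∣ ∞`" of
[cite: BoxerEtAl2021, §7.6 Definition (odd)]. -/
theorem FramedGaloisRep.isOdd_iff_multiplier {ρ : FramedGaloisRep F K n}
    {J : Matrix (Fin n) (Fin n) K} {ν : Field.absoluteGaloisGroup F → K} (hJ : J.det ≠ 0)
    (hJt : Jᵀ = -J) (hJd : ∀ i, J i i = 0)
    (hν : ∀ σ, (ρ σ : Matrix (Fin n) (Fin n) K)ᵀ * J * (ρ σ : Matrix (Fin n) (Fin n) K) = ν σ • J)
    (hn : Odd (n / 2)) :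
    FramedGaloisRep.IsOdd ρ ↔
      ∀ (φ : F →+* ℝ) (c : Field.absoluteGaloisGroup F), IsComplexConjugation φ c → ν c = -1 := by
  haveI : NeZero n := ⟨by rintro rfl; simp at hn⟩
  have hJu : IsUnit J.det := isUnit_iff_ne_zero.mpr hJ
  unfold FramedGaloisRep.IsOdd
  refine forall₃_congr fun φ c hc => ?_
  have hpm : ν c = 1 ∨ ν c = -1 :=
    mul_self_eq_one_iff.mp (by rw [← sq]; exact FramedGaloisRep.multiplier_sq_eq_one hJu hν hc)
  have hdet : ((Matrix.GeneralLinearGroup.det (ρ c) : Kˣ) : K) = ν c := by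
    rw [FramedRep.det_eq_multiplier_pow ρ hJ hJt hJd hν c]
    rcases hpm with h1 | h1 <;> rw [h1]
    · exact one_pow _
    · exact hn.neg_one_pow
  rw [← Units.val_inj, Units.val_neg, Units.val_one, hdet]

/-- **`GSp_{2m}` with `m` even is never odd in the `GL_n` sense**: if `n / 2` is even (e.g.
`GSp_4`), then `det ρ(c) = (ν(c)²)^{n/4} = 1` for every complex conjugation `c`; so for such `n`
the `GSp`-oddness `ν(c) = -1` of [cite: BoxerEtAl2021, §7.6 Definition (odd)] is *not*
`FramedGaloisRep.IsOdd`. [folklore] -/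
theorem FramedGaloisRep.det_complexConjugation_eq_one {ρ : FramedGaloisRep F K n}
    {J : Matrix (Fin n) (Fin n) K} {ν : Field.absoluteGaloisGroup F → K} (hJ : J.det ≠ 0)
    (hJt : Jᵀ = -J) (hJd : ∀ i, J i i = 0)
    (hν : ∀ σ, (ρ σ : Matrix (Fin n) (Fin n) K)ᵀ * J * (ρ σ : Matrix (Fin n) (Fin n) K) = ν σ • J)
    (hn : Even (n / 2)) {φ : F →+* ℝ} {c : Field.absoluteGaloisGroup F}
    (hc : IsComplexConjugation φ c) : Matrix.GeneralLinearGroup.det (ρ c) = 1 := by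
  rw [← Units.val_eq_one, FramedRep.det_eq_multiplier_pow ρ hJ hJt hJd hν c]
  rcases Nat.eq_zero_or_pos n with rfl | hpos
  · simp
  haveI : NeZero n := ⟨hpos.ne'⟩
  obtain ⟨k, hk⟩ := hn
  rw [hk, ← two_mul, pow_mul, FramedGaloisRep.multiplier_sq_eq_one (isUnit_iff_ne_zero.mpr hJ) hν hc,
    one_pow]

end Field

end Framed

end Literature.NumberTheory.GaloisRepresentations
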